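import Literature.AlgebraicGeometry.Frobenioids.IsometricPreStepsPushforward
import Literature.AlgebraicGeometry.Frobenioids.PerfectionCoAngularDivisorsOver
import Literature.AlgebraicGeometry.Frobenioids.CategoriesFactorization
import Mathlib.CategoryTheory.Comma.Arrow
import HarnessLib

/-!
# Frobenioids I, Definition 1.3 (iii)(d): the invariant `x_ψ = (ψ^*)⁻¹ Div ψ` of a pre-step under abstract
# equivalence with a base-identity linear endomorphism (PROOFS)

Mochizuki, *The geometry of Frobenioids I: the general theory*, Kyushu J. Math. **62** (2008)
293–400, §0 p. 17 ("abstractly equivalent"), Definition 1.3 (iii)(d) p. 24, Proposition 1.8 (ii) p. 31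
[cite: MochizukiFrdI2008, Def. 1.3 (iii) p.24]; the combination is the one used by [EtTh] Cor. 3.8, proof
p.81 ("pre-steps `A′ → B` that are abstractly equivalent to an endomorphism that belongs to '`O^▷(−)`'").

PROOF-ONLY, generic over a pre-Frobenioid / Frobenioid `F : C → F_Φ` (abc-iut cell; written for the row
«EtTh:Cor3.8(i)/C38-L05», sub-row L05c of plan/L2/SUBDAG-EtTh-Cor38.md; seat abc-iut-w5-d246):

* `invDiv_endo_eq_div` — for a base-identity endomorphism `ε`, `x_ε = Div ε`;
* `invDiv_eq_pull_div_of_square` / `_of_arrowIso` — if the base-isomorphism `ψ : X → Y` is abstractly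
  equivalent to a base-identity endomorphism `ε : A′ → A′` through `e : (ψ) ≅ (ε)` in the arrow category,
  then `x_ψ = Base(e.right)^* Div ε` (Remark 1.1.1: isomorphisms are linear isometries; linearity of `ε` is
  not even needed);
* `exists_invDiv_eq_pull_div_of_isAbstractlyEquivalent` — the same with the base isomorphism
  `Base Y ≅ Base A′` existentially quantified;
* `isAbstractlyEquivalent_of_invDiv_eq_div` — conversely, in a Frobenioid, a co-angular pre-step
  `ψ : X → Y` with `x_ψ = Div ε` for some `ε ∈ O^▷(Y)` is abstractly equivalent to `ε` (Def. 1.3 (iii)(d):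
  objects of `(C^coa-pre)_Y` with the same invariant are isomorphic over `Y`, `exists_iso_of_invDiv_eq`).
No new definitions; nothing here is specific to the abc programme.
-/

namespace Literature.AlgebraicGeometry.Frobenioids

namespace PreFrobenioid

open CategoryTheory Opposite

universe w v v' u u'

variable {D : Type u} [Category.{v} D] {Φ : Dᵒᵖ ⥤ CommMonCat.{w}}
  {C : Type u'} [Category.{v'} C] {F : C ⥤ ElemFrobenioid Φ}

/-! ### `x_ε` of a base-identity endomorphism -/

/-- For a base-identity endomorphism `ε` (so `Base ε = id`), `(ε^*)⁻¹ Div ε = Div ε`.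
[cite: MochizukiFrdI2008, Def. 1.3 (iii) p.24] -/
theorem invDiv_endo_eq_div {Y : C} (ε : Y ⟶ Y) (hεb : IsBaseIdentity F ε) (h : IsBaseIso F ε) :
    invDiv F ε h = Div F ε :=
  Perfection.invDiv_eq_of_pull_eq ε h (by rw [show Base F ε = 𝟙 _ from hεb, pull_id])

/-- A base-identity endomorphism is a base-isomorphism. [cite: MochizukiFrdI2008, Def. 1.2 (ii) p.21] -/
theorem isBaseIso_of_isBaseIdentity {Y : C} (ε : Y ⟶ Y) (hεb : IsBaseIdentity F ε) : IsBaseIso F ε := by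
  change IsIso (Base F ε)
  rw [show Base F ε = 𝟙 _ from hεb]
  infer_instance

/-! ### Transport of `x_ψ` along an abstract equivalence -/

/-- **`x_ψ` along a square with isomorphisms.**  If `l ≫ ε = ψ ≫ r` with `l : X ≅ A′`, `r : Y ≅ A′`
isomorphisms, `ψ` a base-isomorphism and `ε` a base-identity LINEAR endomorphism, then
`(ψ^*)⁻¹ Div ψ = Base(r)^* Div ε` (isomorphisms are linear isometries, Remark 1.1.1).
[cite: MochizukiFrdI2008, Def. 1.3 (iii) p.24] -/
theorem invDiv_eq_pull_div_of_square (hP : IsPreFrobenioid Φ F) {X Y A' : C} (ψ : X ⟶ Y)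
    (hψ : IsBaseIso F ψ) (ε : A' ⟶ A') (hεb : IsBaseIdentity F ε) (l : X ⟶ A') (r : Y ⟶ A') [IsIso l]
    [IsIso r] (hw : l ≫ ε = ψ ≫ r) : invDiv F ψ hψ = pull Φ (Base F r) (Div F ε) := by
  apply Perfection.invDiv_eq_of_pull_eq
  -- `Base(ψ)^* Base(r)^* Div ε = Base(l ≫ ε)^* Div ε = Base(l)^* Div ε`
  rw [← pull_comp, ← base_comp, ← hw, base_comp, show Base F ε = 𝟙 _ from hεb, Category.comp_id]
  -- `Div ψ = Div(ψ ≫ r) = Div(l ≫ ε) = Base(l)^* Div ε`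
  have h₁ : Div F (ψ ≫ r) = Div F ψ := by
    rw [div_comp, show Div F r = 1 from isIsometry_of_isIso F hP _, map_one, one_mul,
      show degFr F r = 1 from isLinear_of_isIso F _, PNat.one_coe, pow_one]
  have h₂ : Div F (l ≫ ε) = pull Φ (Base F l) (Div F ε) := by
    rw [div_comp, show Div F l = 1 from isIsometry_of_isIso F hP _, one_pow, mul_one]
  rw [← h₁, ← hw, h₂]

/-- **`x_ψ` along an abstract equivalence.**  If `e : (ψ : X → Y) ≅ (ε : A′ → A′)` in the arrow category,
with `ψ` a base-isomorphism and `ε` a base-identity linear endomorphism, then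
`(ψ^*)⁻¹ Div ψ = Base(e.right)^* Div ε`. [cite: MochizukiFrdI2008, Def. 1.3 (iii) p.24] -/
theorem invDiv_eq_pull_div_of_arrowIso (hP : IsPreFrobenioid Φ F) {X Y A' : C} (ψ : X ⟶ Y)
    (hψ : IsBaseIso F ψ) (ε : A' ⟶ A') (hεb : IsBaseIdentity F ε) (e : Arrow.mk ψ ≅ Arrow.mk ε) :
    invDiv F ψ hψ = pull Φ (Base F (e.hom.right : Y ⟶ A')) (Div F ε) := by
  let l : X ⟶ A' := e.hom.left
  let r : Y ⟶ A' := e.hom.right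
  haveI : IsIso l := (Arrow.leftFunc.mapIso e).isIso_hom
  haveI : IsIso r := (Arrow.rightFunc.mapIso e).isIso_hom
  have hw : l ≫ ε = ψ ≫ r := Arrow.w e.hom
  exact invDiv_eq_pull_div_of_square hP ψ hψ ε hεb l r hw

/-- **`x_ψ` of a pre-step abstractly equivalent to an element of `O^▷(A′)`**: there is a base isomorphism
`β : Base Y ≅ Base A′` with `(ψ^*)⁻¹ Div ψ = β^* Div ε`. [cite: MochizukiFrdI2008, Def. 1.3 (iii) p.24] -/
theorem exists_invDiv_eq_pull_div_of_isAbstractlyEquivalent (hP : IsPreFrobenioid Φ F) {X Y A' : C}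
    (ψ : X ⟶ Y) (hψ : IsBaseIso F ψ) (ε : A' ⟶ A') (hεb : IsBaseIdentity F ε) (h : IsAbstractlyEquivalent ψ ε) :
    ∃ β : baseObj F Y ≅ baseObj F A', invDiv F ψ hψ = pull Φ β.hom (Div F ε) := by
  obtain ⟨e⟩ := h
  exact ⟨(baseFunctor F).mapIso (Arrow.rightFunc.mapIso e), invDiv_eq_pull_div_of_arrowIso hP ψ hψ ε hεb e⟩

/-! ### The converse over a fixed target -/

/-- **A co-angular pre-step with `x_ψ = Div ε`, `ε ∈ O^▷(Y)`, is abstractly equivalent to `ε`** (in a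
Frobenioid): `ε` is itself a co-angular pre-step into `Y` with `x_ε = Div ε`, so `ψ` and `ε` are isomorphic
over `Y` (Def. 1.3 (iii)(d)). [cite: MochizukiFrdI2008, Def. 1.3 (iii) p.24] -/
theorem isAbstractlyEquivalent_of_invDiv_eq_div (hF : IsFrobenioid F) {X Y : C} (ψ : X ⟶ Y)
    (hψ : IsCoAngularPreStep F ψ) (ε : Y ⟶ Y) (hεb : IsBaseIdentity F ε) (hεl : IsLinear F ε)
    (h : invDiv F ψ hψ.2.2 = Div F ε) : IsAbstractlyEquivalent ψ ε := by
  have hε : IsCoAngularPreStep F ε := ⟨isCoAngular_endo F hF ε, hεl, isBaseIso_of_isBaseIdentity ε hεb⟩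
  obtain ⟨l, hl⟩ := exists_iso_of_invDiv_eq hF ψ ε hψ hε (h.trans (invDiv_endo_eq_div ε hεb hε.2.2).symm)
  exact ⟨Arrow.isoMk l (Iso.refl Y) (by change l.hom ≫ ε = ψ ≫ 𝟙 Y; rw [hl, Category.comp_id])⟩

/-- **Criterion over a fixed target** (in a Frobenioid): a co-angular pre-step `ψ : X → Y` is abstractly
equivalent to SOME `ε ∈ O^▷(Y)` with `x_ψ = Div ε` iff `x_ψ ∈ Div(O^▷(Y))`.
[cite: MochizukiFrdI2008, Def. 1.3 (iii) p.24] -/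
theorem exists_isAbstractlyEquivalent_endo_iff (hF : IsFrobenioid F) {X Y : C} (ψ : X ⟶ Y)
    (hψ : IsCoAngularPreStep F ψ) :
    (∃ ε : Y ⟶ Y, IsBaseIdentity F ε ∧ IsLinear F ε ∧ invDiv F ψ hψ.2.2 = Div F ε ∧ IsAbstractlyEquivalent ψ ε) ↔
      ∃ ε : Y ⟶ Y, IsBaseIdentity F ε ∧ IsLinear F ε ∧ invDiv F ψ hψ.2.2 = Div F ε :=
  ⟨fun ⟨ε, hb, hl, h, _⟩ => ⟨ε, hb, hl, h⟩,
    fun ⟨ε, hb, hl, h⟩ => ⟨ε, hb, hl, h, isAbstractlyEquivalent_of_invDiv_eq_div hF ψ hψ ε hb hl h⟩⟩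

end PreFrobenioid

end Literature.AlgebraicGeometry.Frobenioids
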